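import Summits.BirchSwinnertonDyer.BirchSwinnertonDyer.Theorems.RamifiedSevenEllipticUnitsHvanAnatomy
import Literature.NumberTheory.DiophantineGeometry.EntireContinuation
import Literature.NumberTheory.EllipticCurves.AnalyticRank
import HarnessLib

/-!
# K7r, line `rubin-formula-zp` (crux `EllipticUnitValueSevenOfGZK`, stmt-BirchSwinnertonDyer-19945), stub
# S_sat-Zp: the binder `hvan` of (B1) in the REPAIRED currency `HasEntireContinuationFrom (3/2)` —
# «hvan′ ⟸ φ-pin + r_an(W) ≠ 0» and (B1′) `z(𝟙) ∈ S_p(E/K)` as THEOREMS (companion of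
# `RamifiedSevenEllipticUnitsHvanAnatomy.lean`; cell `bsd-cm`, seat `bsd-cm-k7r-c3` g7; THEOREMS ONLY —
# no definition, no named fact, nothing asserted)

HONEST FRAMING. The closer `RelaxedEqCompact.relaxed_le_mordellWeilKummerSpan_of_hvan` (seat k7r-c2,
p472558) of the registered stub S_sat-Zp (`X12.O11.RamifiedCMBottomSaturationAtZp W 7`) needs
`z(𝟙) ∈ S_p(E/K)`, obtained from (B1) `BottomClass.bottom_mem_compactSelmerOver` (seat ram, p446875)
under its binder

  `hvan : ∀ χ r, IsAcCharacter ι κ 0 χ r → ∃ hL : LFunction.HasEntireContinuation (heckeLFunction (φ * χ)),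
            hL.continuation 1 = 0`,

which the line card (`Lines/rubin-formula-zp.md`) expected to discharge from the φ-pin of the datum
(`∀ s, 3/2 < re s → heckeLFunction φ s = W.LSeries s`) and `r_an(W) = 1`. The companion file
`RamifiedSevenEllipticUnitsHvanAnatomy.lean` (§1–§3) proves: level-`0` rigidity (`IsAcCharacter ι κ 0 χ r
↔ χ = 1 ∧ r = 1`); `hvan ↔ ∃ hL : LFunction.HasEntireContinuation (heckeLFunction φ), hL.continuation 1
= 0` — a threshold-`1` continuation of the RAW weight-one Euler product, which the φ-pin (`re s > 3/2`
only) cannot supply and which fails on the strip `1 < re s < 3/2`; and that the companion binder `hcont`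
is unsatisfiable for every `φ` (`ζ_K` has a pole). This file gives the POSITIVE side:
* §4 THE REPAIRED READING (proved): over the tree's `DiophantineGeometry.LFunction.HasEntireContinuationFrom
  (3/2)` / `entireContinuationFrom (3/2)` (EntireContinuation.lean, full API, uniqueness by the identity
  theorem), the φ-pin together with `W.HasEntireLFunction` makes `W.entireLFunction` THE continuation of
  `heckeLFunction φ` from `re s > 3/2`, and in positive analytic rank its value at `1` is `0`; hence the
  repaired binder `hvan′` (`HasEntireContinuationFrom (3/2)` + value `0` at `1`, for every level-`0`
  pair) is a THEOREM under the pin (`hvan'_of_pin`). Under the pin, the old `hvan` holds iff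
  `HasEntireContinuation (heckeLFunction φ)` (`hvan_iff_hasEntireContinuation_of_pin`).
* §5 (B1′) (proved): the proof of (B1) run with the level-`0` reciprocity law read in the repaired
  currency (hypothesis `herl'` — literally the field `EllipticUnitClassData.erl` at `n = 0` after the
  repair) gives `z(𝟙) ∈ S_p(E/K)` from the pin, `L(W, ·)` entire and `r_an(W) ≠ 0`, with NO `hvan`
  binder left: `bottom_mem_compactSelmerOver_of_erl'`.

CONSEQUENCES (planner tier, D-0014 — this seat edits no Literature structure): (a) at a pinned datum
the field `EllipticUnitClassData.erl` is vacuous as typed (it quantifies over an empty type), so the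
datum carries no `L`-value content and (B1)/`…_of_hvan` cannot be fed — the S_sat-Zp closer must go
through the rank route or through a repaired `erl`; (b) repair (R-a) = replace
`LFunction.HasEntireContinuation (heckeLFunction (φ*χ))` / `hL.continuation 1` in `erl` (and in `hvan`,
`hcont`) by `HasEntireContinuationFrom (3/2) (heckeLFunction (φ*χ))` / `entireContinuationFrom (3/2) … 1`;
§4–§5 are the lemmas the repaired line consumes; (c) the value law of 19945, S_open, S_dict′, S_B4′ and
the IMC identity never mention `erl`/`hvan` and are untouched. Supports, does not close,
stmt-BirchSwinnertonDyer-19945. PARTITION: CornerF-ramified@7 (B13/O11) × 𝒞₇ × 7 — types-the-object-of.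
BSD is not touched by any of this.

References: [BKNO] A. Burungale, S. Kobayashi, K. Nakamura, K. Ota, arXiv:2608.06879 (2026), Def. 4.2,
Prop. 4.10, Lemma 7.1 [BurungaleKobayashiNakamuraOta2026]; J. W. S. Cassels, A. Fröhlich (eds.),
*Algebraic Number Theory* (1967), Ch. VII §4 Prop. 4.1 [CasselsFrohlichANT1967]; J. Neukirch,
*Algebraic Number Theory* (1999), Ch. VII (5.2), Cor. (5.11) [NeukirchANT1999]; J. Silverman, *Advanced
Topics in the Arithmetic of Elliptic Curves* (1994), Ch. II Thm. 10.5 [SilvermanATAEC1994]; cell files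
`Lines/rubin-formula-zp.md`, STATUS 2026-08-27T00:21Z (this seat's FINDING), MEMO-k7r-c3-g7-HVAN.md.
-/

set_option linter.dupNamespace false

noncomputable section

open scoped Classical

open scoped Topology

open NumberField IsDedekindDomain Field Polynomial Filter Complex
  Literature.NumberTheory.GaloisRepresentations
  Literature.NumberTheory.EllipticCurves
  Literature.NumberTheory.EllipticCurves.BurungaleKobayashiNakamuraOta2026

namespace Summit.BirchSwinnertonDyer.BirchSwinnertonDyer.Theorems.RamifiedSevenEllipticUnits.HvanAnatomy

/-! ### §4. The REPAIRED reading over the tree's `HasEntireContinuationFrom (3/2)`: the continuation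
of `L(φ, s)` from the half-plane where the φ-pin lives IS `L(W, s)`, and it vanishes at `1` in positive
analytic rank — so the repaired `hvan′` is PROVABLE from the pin -/

section Repaired

open Literature.NumberTheory.DiophantineGeometry

variable {K : Type} [Field K] [NumberField K] {p : ℕ} [Fact p.Prime]
  {W : WeierstrassCurve ℚ} {φ : HeckeCharacter K}

/-- An entire continuation from `re s > 1` (the old binder) is in particular one from `re s > c` for
every `c ≥ 1`, and its chosen value function IS `entireContinuationFrom c` (uniqueness by the
identity theorem): the repaired binder is implied by the old one wherever the old one is inhabited.
[folklore] -/
theorem continuation_eq_entireContinuationFrom {f : ℂ → ℂ} (hL : LFunction.HasEntireContinuation f)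
    {c : ℝ} (hc : 1 ≤ c) : hL.continuation = LFunction.entireContinuationFrom c f :=
  (LFunction.entireContinuationFrom_eq_of_mem
    ⟨hL.differentiable_continuation, fun _ hs ↦ hL.continuation_eq (lt_of_le_of_lt hc hs)⟩).symm

/-- **Under the φ-pin, `L(W, ·)` (the tree's `W.entireLFunction`) is an entire continuation of
`heckeLFunction φ` from `re s > 3/2`** (given that `L(W, s)` is entire, `W.HasEntireLFunction` —
for `W/ℚ` the named fact `hasEntireLFunction_rat`; for a CM frame also Deuring–Hecke).
[cite: SilvermanATAEC1994, Ch. II Thm. 10.5 (b) (the clause `L(φ,s) = L(E/ℚ,s)`)] -/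
theorem entireLFunction_mem_entireContinuationsFrom_of_pin (hW : W.HasEntireLFunction)
    (hpin : ∀ s : ℂ, 3 / 2 < s.re → heckeLFunction φ s = W.LSeries s) :
    W.entireLFunction ∈ LFunction.entireContinuationsFrom (3 / 2) (heckeLFunction φ) :=
  ⟨W.differentiable_entireLFunction hW, fun s hs ↦ by
    rw [hpin s hs]
    exact W.entireLFunction_eq_LSeries hW hs⟩

/-- **The φ-pin gives the repaired continuation binder**: `HasEntireContinuationFrom (3/2)
(heckeLFunction φ)`. [cite: SilvermanATAEC1994, Ch. II Thm. 10.5 (b)] -/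
theorem hasEntireContinuationFrom_of_pin (hW : W.HasEntireLFunction)
    (hpin : ∀ s : ℂ, 3 / 2 < s.re → heckeLFunction φ s = W.LSeries s) :
    LFunction.HasEntireContinuationFrom (3 / 2) (heckeLFunction φ) :=
  ⟨_, entireLFunction_mem_entireContinuationsFrom_of_pin hW hpin⟩

/-- **… and its continuation IS `L(W, ·)`**: `entireContinuationFrom (3/2) (heckeLFunction φ) =
W.entireLFunction`. [cite: SilvermanATAEC1994, Ch. II Thm. 10.5 (b)] -/
theorem entireContinuationFrom_eq_entireLFunction_of_pin (hW : W.HasEntireLFunction)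
    (hpin : ∀ s : ℂ, 3 / 2 < s.re → heckeLFunction φ s = W.LSeries s) :
    LFunction.entireContinuationFrom (3 / 2) (heckeLFunction φ) = W.entireLFunction :=
  LFunction.entireContinuationFrom_eq_of_mem (entireLFunction_mem_entireContinuationsFrom_of_pin hW hpin)

/-- In positive analytic rank the entire `L`-function vanishes at `s = 1` (definition of the order of
vanishing `analyticRank = ord_{s=1}`, Mathlib `analyticOrderAt`). [cite: BirchSwinnertonDyer1965] -/
theorem entireLFunction_one_eq_zero_of_analyticRank_ne_zero (hW : W.HasEntireLFunction)
    (hr : W.analyticRank ≠ 0) : W.entireLFunction 1 = 0 := by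
  have han : AnalyticAt ℂ W.entireLFunction 1 := (W.differentiable_entireLFunction hW).analyticAt 1
  by_contra hne
  apply hr
  change (analyticOrderAt W.entireLFunction 1).toNat = 0
  rw [han.analyticOrderAt_eq_zero.mpr hne]
  rfl

/-- **The repaired value clause**: under the φ-pin, in positive analytic rank,
`entireContinuationFrom (3/2) (heckeLFunction φ) 1 = L(W, 1) = 0`. [cite: BirchSwinnertonDyer1965] -/
theorem entireContinuationFrom_one_eq_zero_of_pin (hW : W.HasEntireLFunction)
    (hpin : ∀ s : ℂ, 3 / 2 < s.re → heckeLFunction φ s = W.LSeries s) (hr : W.analyticRank ≠ 0) :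
    LFunction.entireContinuationFrom (3 / 2) (heckeLFunction φ) 1 = 0 := by
  rw [entireContinuationFrom_eq_entireLFunction_of_pin hW hpin]
  exact entireLFunction_one_eq_zero_of_analyticRank_ne_zero hW hr

/-- **`hvan′` — the binder of (B1) in the REPAIRED currency — is a THEOREM under the φ-pin in positive
analytic rank**: for every level-`0` character pair `(χ, r)` (necessarily `(𝟙, 𝟙)`), `L(φχ, s) =
L(φ, s)` has an entire continuation from `re s > 3/2` whose value at `1` is `0`. This is the lemma
«hvan ⟸ pin + r_an(W) = 1» of the line card `Lines/rubin-formula-zp.md`, in the only currency in which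
it is true. [cite: BurungaleKobayashiNakamuraOta2026, Lemma 7.1 (arXiv:2608.06879 p. 40) (claim; preprint; shape only — the step «L(φ,1) = 0 ⇒ z(𝟙) crystalline at 𝔭»)] -/
theorem hvan'_of_pin (ι : PadicAlgCl p ≃+* ℂ) (κ : ZpExtension K p) (hW : W.HasEntireLFunction)
    (hpin : ∀ s : ℂ, 3 / 2 < s.re → heckeLFunction φ s = W.LSeries s) (hr : W.analyticRank ≠ 0) :
    ∀ (χ : HeckeCharacter K) (r : FramedGaloisRep K (PadicAlgCl p) 1), IsAcCharacter ι κ 0 χ r →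
      LFunction.HasEntireContinuationFrom (3 / 2) (heckeLFunction (φ * χ)) ∧
        LFunction.entireContinuationFrom (3 / 2) (heckeLFunction (φ * χ)) 1 = 0 := by
  intro χ r hχ
  obtain rfl := eq_one_of_isAcCharacter_zero hχ
  rw [mul_one]
  exact ⟨hasEntireContinuationFrom_of_pin hW hpin, entireContinuationFrom_one_eq_zero_of_pin hW hpin hr⟩

/-- **Consistency of the two currencies**: IF the old binder is inhabited at a pinned datum
(`hL : HasEntireContinuation (heckeLFunction φ)`), its value at `1` is the repaired one, `L(W, 1)`.
[folklore] -/
theorem continuation_one_eq_entireLFunction_one_of_pin (hW : W.HasEntireLFunction)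
    (hpin : ∀ s : ℂ, 3 / 2 < s.re → heckeLFunction φ s = W.LSeries s)
    (hL : LFunction.HasEntireContinuation (heckeLFunction φ)) :
    hL.continuation 1 = W.entireLFunction 1 := by
  rw [continuation_eq_entireContinuationFrom hL (c := 3 / 2) (by norm_num),
    entireContinuationFrom_eq_entireLFunction_of_pin hW hpin]

/-- **Under the φ-pin in positive analytic rank, `hvan` is EXACTLY the threshold-`1` continuation of
the raw Euler product of `φ`**: the value clause is then automatic (`= L(W, 1) = 0`), so (B1)'s binder
holds iff `LFunction.HasEntireContinuation (heckeLFunction φ)` — a statement about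
`∏'_v (1 - φ(ϖ_v) q_v^{-s})⁻¹` on the strip `1 < re s ≤ 3/2`, outside the pin's range, where the
weight-one product does not converge absolutely. [folklore] -/
theorem hvan_iff_hasEntireContinuation_of_pin (ι : PadicAlgCl p ≃+* ℂ) (κ : ZpExtension K p)
    (hW : W.HasEntireLFunction) (hpin : ∀ s : ℂ, 3 / 2 < s.re → heckeLFunction φ s = W.LSeries s)
    (hr : W.analyticRank ≠ 0) :
    (∀ (χ : HeckeCharacter K) (r : FramedGaloisRep K (PadicAlgCl p) 1), IsAcCharacter ι κ 0 χ r →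
      ∃ hL : LFunction.HasEntireContinuation (heckeLFunction (φ * χ)), hL.continuation 1 = 0) ↔
    LFunction.HasEntireContinuation (heckeLFunction φ) := by
  rw [hvan_iff]
  refine ⟨fun ⟨hL, _⟩ ↦ hL, fun hL ↦ ⟨hL, ?_⟩⟩
  rw [continuation_one_eq_entireLFunction_one_of_pin hW hpin hL]
  exact entireLFunction_one_eq_zero_of_analyticRank_ne_zero hW hr

end Repaired

/-! ### §5. (B1′): the bottom class is crystalline at `𝔭` — (B1) with its binder DISCHARGED, in the
repaired currency (the hypothesis `herl'` is the field `erl` at level `0` read over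
`entireContinuationFrom (3/2)`; after the repair it is `D.erl 0` itself) -/

section RepairedB1

open WeierstrassCurve Literature.NumberTheory.DiophantineGeometry
  Literature.NumberTheory.EllipticCurves.Rank1Residual

variable {W : WeierstrassCurve ℚ} [W.IsElliptic] {p : ℕ} [Fact p.Prime]
  {K : Type} [Field K] [NumberField K] {𝔭 : HeightOneSpectrum (𝓞 K)}
  {κ : ZpExtension K p} {γ : absoluteGaloisGroup K}
  {ι : PadicAlgCl p ≃+* ℂ} {φ : HeckeCharacter K} {Ω : ℂ} {𝓔 : AcDualExpSystem W p K 𝔭 κ ι}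

/-- **(B1′) `z(𝟙) ∈ S_p(E/K)` from the φ-pin, UNCONDITIONALLY in the repaired currency.** If the datum's
explicit reciprocity law at level `0` is read over the continuation from `re s > 3/2` (hypothesis
`herl'`: `δ 0 r (z 0) = ι⁻¹(L(φχ, 1)/Ω)` with `L(φχ, 1) := entireContinuationFrom (3/2) (heckeLFunction
(φχ)) 1` — the field `EllipticUnitClassData.erl` after repair (R-a)), then under the φ-pin, `L(W, s)`
entire and `r_an(W) ≠ 0`, every level-`0` value `δ 0 r (z 0)` vanishes (`hvan'_of_pin`), so `z 0` is
Kummer above `𝔭` (exact kernel `δ_eq_zero_iff`) and lies in the FULL compact Selmer group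
(`relaxed ⊓ localKummer = compact`). Same proof as (B1) `BottomClass.bottom_mem_compactSelmerOver`
(p446875), whose binder `hvan` is here a theorem instead of a hypothesis.
[cite: BurungaleKobayashiNakamuraOta2026, Lemma 7.1 and Prop. 4.10 (arXiv:2608.06879 pp. 31, 40) (claim; preprint; shape only)] -/
theorem bottom_mem_compactSelmerOver_of_erl' (D : EllipticUnitClassData W p K 𝔭 κ γ ι φ Ω 𝓔)
    (herl' : ∀ (χ : HeckeCharacter K) (r : FramedGaloisRep K (PadicAlgCl p) 1),
      IsAcCharacter ι κ 0 χ r →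
        𝓔.δ 0 r (D.z 0) =
          ((ι.symm (LFunction.entireContinuationFrom (3 / 2) (heckeLFunction (φ * χ)) 1 / Ω) :
            PadicAlgCl p) : ℂ_[p]))
    (hW : W.HasEntireLFunction) (hpin : ∀ s : ℂ, 3 / 2 < s.re → heckeLFunction φ s = W.LSeries s)
    (hr : W.analyticRank ≠ 0) :
    D.z 0 ∈ (W.baseChange K).compactSelmerOver (κ.layerSubgroup 0) p := by
  have hrel : D.z 0 ∈ (W.baseChange K).relaxedCompactSelmerOver (κ.layerSubgroup 0) p {𝔭} :=
    D.z_mem 0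
  have hcomp : D.z 0 ∈ (W.baseChange K).compatiblePi (κ.layerSubgroup 0) p :=
    (mem_relaxedCompactSelmerOver_iff.1 hrel).2
  have hkum : D.z 0 ∈ (W.baseChange K).localKummerPi (κ.layerSubgroup 0) p {𝔭} := by
    refine (𝓔.δ_eq_zero_iff 0 _ hcomp).1 fun χ r h ↦ ?_
    rw [herl' χ r h, (hvan'_of_pin ι κ hW hpin hr χ r h).2, zero_div, map_zero]
    rfl
  rw [← (W.baseChange K).relaxedCompactSelmerOver_inf_localKummerPi (κ.layerSubgroup 0) p {𝔭}]
  exact ⟨hrel, hkum⟩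

/-! ### §6. Referee gate (ii) (D121): (B1′) is EXERCISED by the constructible level-`0` pair `(𝟙, 𝟙)` —
the repaired reciprocity law is never vacuous at level `0`, and at that pair it evaluates to `L(W, 1)/Ω` -/

/-- **The repaired level-`0` reciprocity law at the CONSTRUCTIBLE pair `(𝟙, 𝟙)`
(`HvanAnatomy.isAcCharacter_zero_one_one`): `δ 0 𝟙 (z 0) = ι⁻¹(L(W, 1)/Ω)`** under the φ-pin with `L(W, ·)`
entire — the `exp*` of the bottom class IS the central value over the period, read through the datum. So
`herl'` (the field `erl` at `n = 0` after repair (R-a)) is instantiated, not vacuous (referee gate (ii)).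
[cite: BurungaleKobayashiNakamuraOta2026, Prop. 4.10 and Lemma 7.1 (arXiv:2608.06879 pp. 31, 40) (claim; preprint; shape only)] -/
theorem δ_one_bottom_eq_of_erl' (D : EllipticUnitClassData W p K 𝔭 κ γ ι φ Ω 𝓔)
    (herl' : ∀ (χ : HeckeCharacter K) (r : FramedGaloisRep K (PadicAlgCl p) 1),
      IsAcCharacter ι κ 0 χ r →
        𝓔.δ 0 r (D.z 0) =
          ((ι.symm (LFunction.entireContinuationFrom (3 / 2) (heckeLFunction (φ * χ)) 1 / Ω) :
            PadicAlgCl p) : ℂ_[p]))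
    (hW : W.HasEntireLFunction) (hpin : ∀ s : ℂ, 3 / 2 < s.re → heckeLFunction φ s = W.LSeries s) :
    𝓔.δ 0 1 (D.z 0) = ((ι.symm (W.entireLFunction 1 / Ω) : PadicAlgCl p) : ℂ_[p]) := by
  have h := herl' 1 1 (isAcCharacter_zero_one_one ι κ)
  rw [mul_one, entireContinuationFrom_eq_entireLFunction_of_pin hW hpin] at h
  exact h

/-- **… and in positive analytic rank it VANISHES: `δ 0 𝟙 (z 0) = 0`** — the single instance of the
exact-kernel criterion `δ_eq_zero_iff` that (B1′) actually uses (by level-`0` rigidity every level-`0`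
pair is `(𝟙, 𝟙)`), displayed on its own. [cite: BurungaleKobayashiNakamuraOta2026, Lemma 7.1 (arXiv:2608.06879 p. 40) (claim; preprint; shape only)] -/
theorem δ_one_bottom_eq_zero_of_erl' (D : EllipticUnitClassData W p K 𝔭 κ γ ι φ Ω 𝓔)
    (herl' : ∀ (χ : HeckeCharacter K) (r : FramedGaloisRep K (PadicAlgCl p) 1),
      IsAcCharacter ι κ 0 χ r →
        𝓔.δ 0 r (D.z 0) =
          ((ι.symm (LFunction.entireContinuationFrom (3 / 2) (heckeLFunction (φ * χ)) 1 / Ω) :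
            PadicAlgCl p) : ℂ_[p]))
    (hW : W.HasEntireLFunction) (hpin : ∀ s : ℂ, 3 / 2 < s.re → heckeLFunction φ s = W.LSeries s)
    (hr : W.analyticRank ≠ 0) : 𝓔.δ 0 1 (D.z 0) = 0 := by
  rw [δ_one_bottom_eq_of_erl' D herl' hW hpin, entireLFunction_one_eq_zero_of_analyticRank_ne_zero hW hr,
    zero_div, map_zero]
  rfl

end RepairedB1

end Summit.BirchSwinnertonDyer.BirchSwinnertonDyer.Theorems.RamifiedSevenEllipticUnits.HvanAnatomy

end
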